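import Summits.QuantumFields.YangMills.Theorems.UnitScaleTiltProp7CentreHarmonicDivEngine
import Summits.QuantumFields.YangMills.Theorems.UnitScaleTiltProp7CentreHarmonicDivFlat
import Summits.QuantumFields.YangMills.Theorems.BalabanUVNodesN07PointFeasibilityOneLevelV1
import Literature.MathematicalPhysics.QuantumFieldTheory.Balaban1983to89.B5Eq117TorusCarriers
import Literature.MathematicalPhysics.QuantumFieldTheory.BalabanImbrieJaffe1984to88.BIJ85Thm711TorusTransport
import HarnessLib

/-!
# Route `UnitScaleTilt`, crux K1 «MinimiserStabilityRegPr» (stmt-QuantumFields-19200), route-R E′ path (α′) — THE DICTIONARY that discharges the displayed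
# LEMMA-H row `hH` of ✓`Prop7CentreHarmonicDivEngine` from ✓`Prop7CentreHarmonicDivFlat.lemmaH_flat` (B5 carrier `Tor (fine n M)`), and the resulting
# UNCONDITIONAL flat ζ-row «`Q^{(k)}Y = 0 ∧ Δ(∂^*Y) = 0` off the `k`-centres ⟹ `Σ‖∂^*Y‖²_F ≤ (3π⁴/4)(2 + 600N²L⁴/(√L−1)²)·Σ‖∂Y‖²_F`»

Cell `ym3-torus`, width seat `ym3-torus-px17` (gen 0; namer ★ym-ust-19200-p1 g14 «px17: ENGINE GO» 2026-08-28 17:21Z; ★ym-routeR-w3 g5 17:23Z «second hand OK»,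
`lemmaH_flat` by name).  THEOREMS ONLY (0 `def`, 0 `sorry`); `--supports stmt-QuantumFields-19200`, count-neutral.  YM₃ on T³ is a ladder rung (R3), not the Clay
problem; nothing here claims the stub, the crux, d = 4 or the mass gap.

THE DICTIONARY.  `Site P 0` (finest torus of `Setup`, `2L^{m+K}` sites per direction) IS level `k` of the B5 tower over `Site P k`: the carrier identification is
✓`B5Eq117TorusCarriers.EK hk : Site P 0 ≃ Tor (fine (L^k) (Mk P k))` (componentwise `ZMod.ringEquivCongr`, `Mk P k = const (sitesPerDir k)`, `Site P k` IS
`Tor (Mk P k)`).  Under `EK`: unit steps go to unit steps (§1), the `k`-fold CENTRE `embIter k y` goes to the block point of middle offset `bpt y j_mid =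
up y + ι(j_mid)`, `j_mid = (L^k − 1)/2` (§1; `Setup.emb` is the centred convention, B5's `up` the corner one — a constant translation `w = ι(j_mid)`), the
positive Laplacian `laplace 1` goes to `LapS … 1` and `LapS … n = n²·LapS … 1` (§2).  §3 reads `lemmaH_flat` through the translate `ψ″(t) = ψ(EK⁻¹(t + w))`:
its comb is `g = Δ_n²ψ″` (zero-sum), `Δ_n⁻¹g = Δ_nψ″` (✓`LapSinv_LapS_of_orth`), `Δ_n⁻²g∘up = (ψ″ − Pker ψ″)∘up` with `Pker ψ″` constant (✓`Pker_const`), so the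
printed inequality becomes `n⁴·Σ_x(Δψ)² ≤ (dπ⁴/4)·n^d·Σ_c(ψ(c₊) − ψ(c₋))²`, i.e. at `d = 3` the row `hH` with `C_H = 3π⁴/4`.  §4 plugs it into the ENGINE.

WHAT IS PROVED (ns `…Theorems.Prop7CentreHarmonicDivDictionary`; forward unit steps `EK_shift`∕`EK_symm_add_unitVec` are ✓`BIJ85Thm711TorusTransport`'s): §1 `EK_unshift`, `EK_symm_sub_unitVec`, `blockSiteK_mid_eq_embIter`,
`EK_embIter`, `shift_eq_add_unitVec`; §2 `LapS_one_mulVec_transl`, `LapS_natCast_mulVec`, `sum_LapS_mulVec`; §3 ★★ `hH_of_lemmaH_flat`; §4 ★★★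
`sum_diverg_normSq_le_curl_normSq` (the flat ζ-row, unconditional) and `…_T3`.
HONEST SCOPE.  Flat, linear bookkeeping between two typings of one torus plus the ENGINE; the analysis is ✓`lemmaH_flat` (★routeR-w3 g5) and the N7 chain.

References: T. Bałaban, CMP 95 (1984) 17–40 [Balaban1984PropagatorsI] ((1.6) p.18, (1.17)–(1.21) pp.20–21, Prop. 1.1 (1.90) p.33); CMP 102 (1985) 277–309
[Balaban1985Variational] (Prop. 7 p.299); CMP 99 (1985) 389–434 [Balaban1985BackgroundPropagators] ((3.118)–(3.122) pp.419–420, Thm 3.11 p.416).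
-/

set_option autoImplicit false

noncomputable section

open scoped BigOperators Matrix ComplexConjugate

namespace Summit.QuantumFields.YangMills.Theorems.Prop7CentreHarmonicDivDictionary

open Literature.MathematicalPhysics.QuantumFieldTheory.Balaban1983to89
open Finset LatticeFieldCalculus BlockAveragingEMLLinearised
open B15DeterminingSets (embIter)
open B10StarCount (sum_pbond)
open B5Prop11Plancherel (Tor fine unitVec)
open B5Block118 (up iota bpt)
open B5Blocks16 (bpt_val bpt_injective)
open B5Action121 (LapS LapS_mulVec)
open B5LaplaceInverse (LapSinv Pker LapSinv_LapS_of_orth LapSinv_mul_LapS Pker_const)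
open B5LaplaceSpectral (LapS_const)
open B5Eq117TorusCarriers (Mk EK EK_apply blockSiteK val_blockSiteK EK_blockSiteK)
open Summit.QuantumFields.YangMills.BalabanUVNodes.N07PointFeasibilityOneLevelV1 (val_embIter)
open Literature.MathematicalPhysics.QuantumFieldTheory.BalabanImbrieJaffe1984to88.BIJ85Thm711TorusTransport (EK_shift EK_symm_add_unitVec)

variable {P : Params} {k : ℕ}

/-! ## §1 Carrier letters: unit steps, the centres, the translate -/

/-- `EK (x − e_μ) = EK x − e_μ` (backward companion of ✓`BIJ85Thm711TorusTransport.EK_shift`). [cite: Balaban1984PropagatorsI, (1.17) p.20] -/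
theorem EK_unshift (hk : k ≤ P.m + P.K) (x : Site P 0) (μ : Fin P.d) :
    EK hk (x.unshift μ) = EK hk x - unitVec (fine (P.L ^ k) (Mk P k)) μ := by
  funext ν
  simp only [EK_apply, Pi.sub_apply, unitVec, Site.unshift]
  by_cases hν : ν = μ
  · subst hν
    rw [Function.update_self, Pi.single_eq_same, map_sub, map_one]
  · rw [Function.update_of_ne hν, Pi.single_eq_of_ne hν, sub_zero]

/-- `EK⁻¹ (t − e_μ) = (EK⁻¹ t) − e_μ`. [cite: Balaban1984PropagatorsI, (1.17) p.20] -/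
theorem EK_symm_sub_unitVec (hk : k ≤ P.m + P.K) (t : Tor (fine (P.L ^ k) (Mk P k))) (μ : Fin P.d) :
    (EK hk).symm (t - unitVec (fine (P.L ^ k) (Mk P k)) μ) = ((EK hk).symm t).unshift μ := by
  apply (EK hk).injective
  rw [Equiv.apply_symm_apply, EK_unshift, Equiv.apply_symm_apply]

/-- `(L^k − 1)/2 < L^k`. [folklore] -/
theorem half_pred_pow_lt (P : Params) (k : ℕ) : (P.L ^ k - 1) / 2 < P.L ^ k := by
  have h : 0 < P.L ^ k := pow_pos P.L_pos k
  omega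

/-- **THE `k`-FOLD CENTRE IS THE BLOCK POINT OF MIDDLE OFFSET**: `embIter k y = blockSiteK k y j_mid`, `j_mid = (L^k − 1)/2` in every direction (labels
`y·L^k + (L^k − 1)/2`, ✓`val_embIter` = ✓`val_blockSiteK`). [cite: Balaban1987RG1, (0.1) p.251; Balaban1984PropagatorsI, (1.18) p.20] -/
theorem blockSiteK_mid_eq_embIter (hk : k ≤ P.m + P.K) (y : Site P k) :
    blockSiteK k y (fun _ => ⟨(P.L ^ k - 1) / 2, half_pred_pow_lt P k⟩) = embIter k y := by
  funext ν
  apply ZMod.val_injective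
  rw [val_blockSiteK hk, val_embIter hk]

/-- **CENTRES GO TO TRANSLATED CORNER POINTS**: `EK (embIter k y) = up y + ι(j_mid)`. [cite: Balaban1984PropagatorsI, (1.18) p.20] -/
theorem EK_embIter (hk : k ≤ P.m + P.K) (y : Site P k) :
    EK hk (embIter k y) = up (P.L ^ k) (Mk P k) y + iota (P.L ^ k) (Mk P k) (fun _ => ⟨(P.L ^ k - 1) / 2, half_pred_pow_lt P k⟩) := by
  rw [← blockSiteK_mid_eq_embIter hk, EK_blockSiteK hk]
  rfl

/-- a unit step of the unit lattice `T^{(k)}` in the two typings: `y.shift ν = y + e_ν`. [folklore] -/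
theorem shift_eq_add_unitVec (y : Tor (Mk P k)) (ν : Fin P.d) :
    (Site.shift (P := P) (j := k) y ν : Tor (Mk P k)) = y + unitVec (Mk P k) ν := by
  funext κ
  show Function.update y ν (y ν + 1) κ = y κ + (Pi.single ν (1 : ZMod (Mk P k ν)) : Tor (Mk P k)) κ
  by_cases h : κ = ν
  · subst h; rw [Function.update_self, Pi.single_eq_same]
  · rw [Function.update_of_ne h, Pi.single_eq_of_ne h, add_zero]


/-! ## §2 Operator letters on the B5 carrier -/

section Operators

variable {d : ℕ} (N : Fin d → ℕ) [∀ μ, NeZero (N μ)]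

/-- `Δ_c = |c|²·Δ_1` pointwise on the B5 torus (`c = n` a natural number). [cite: Balaban1984PropagatorsI, (1.21) p.21] -/
theorem LapS_natCast_mulVec (n : ℕ) (f : Tor N → ℂ) (t : Tor N) :
    (LapS N (n : ℂ) *ᵥ f) t = ((n : ℂ) ^ 2) * (LapS N 1 *ᵥ f) t := by
  rw [LapS_mulVec, LapS_mulVec, Finset.mul_sum]
  refine Finset.sum_congr rfl fun ν _ => ?_
  rw [map_natCast, map_one]
  ring

/-- `Σ_x (Δf)(x) = 0` on the torus (translation invariance of the sum). [cite: Balaban1984PropagatorsI, (1.21) p.21] -/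
theorem sum_LapS_mulVec (c : ℂ) (f : Tor N → ℂ) : ∑ t, (LapS N c *ᵥ f) t = 0 := by
  simp only [LapS_mulVec]
  rw [Finset.sum_comm]
  refine Finset.sum_eq_zero fun ν _ => ?_
  have h1 : ∑ t, f (t + unitVec N ν) = ∑ t, f t :=
    Fintype.sum_equiv (Equiv.addRight (unitVec N ν)) (fun t => f (t + unitVec N ν)) f (fun _ => rfl)
  have h2 : ∑ t, f (t - unitVec N ν) = ∑ t, f t :=
    Fintype.sum_equiv (Equiv.subRight (unitVec N ν)) (fun t => f (t - unitVec N ν)) f (fun _ => rfl)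
  have h3 : ∑ t, (2 * f t - f (t + unitVec N ν) - f (t - unitVec N ν)) = 0 := by
    rw [Finset.sum_sub_distrib, Finset.sum_sub_distrib, h1, h2, ← Finset.mul_sum]
    ring
  rw [← Finset.mul_sum, h3, mul_zero]

end Operators

/-- **`Δ` UNDER THE DICTIONARY**: for a real site function `ψ` on `T^{(0)}` and any translate `w`, the B5 Laplacian `LapS … 1` of `t ↦ ψ(EK⁻¹(t + w))` at `t` is the record's
`laplace 1 ψ` at `EK⁻¹(t + w)`. [cite: Balaban1984PropagatorsI, (1.21) p.21] -/
theorem LapS_one_mulVec_transl (hk : k ≤ P.m + P.K) (ψ : SiteField P 0 ℝ) (w : Tor (fine (P.L ^ k) (Mk P k)))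
    (t : Tor (fine (P.L ^ k) (Mk P k))) :
    (LapS (fine (P.L ^ k) (Mk P k)) 1 *ᵥ (fun s => ((ψ ((EK hk).symm (s + w)) : ℝ) : ℂ))) t
      = ((laplace 1 ψ ((EK hk).symm (t + w)) : ℝ) : ℂ) := by
  have hl : ∀ x : Site P 0, laplace 1 ψ x = ∑ μ : Fin P.d, (ψ x + ψ x - ψ (x.shift μ) - ψ (x.unshift μ)) := fun x => by
    simp only [laplace, one_pow, one_smul]
  rw [LapS_mulVec, hl]
  push_cast
  refine Finset.sum_congr rfl fun ν _ => ?_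
  rw [map_one, one_mul, add_right_comm t (unitVec _ ν) w, EK_symm_add_unitVec, sub_add_eq_add_sub, EK_symm_sub_unitVec]
  ring

/-! ## §3 The displayed row `hH` of the ENGINE from `lemmaH_flat` -/

/-- ★★ **LEMMA H IN THE RECORD'S LETTERS** (`d = 3`): for every real `ψ` on the finest torus with `Δ²ψ = 0` off the `k`-centres,
`L^k·Σ_x (Δψ)(x)² ≤ (3π⁴/4)·Σ_c (ψ(embIter k c₊) − ψ(embIter k c₋))²` — ✓`Prop7CentreHarmonicDivFlat.lemmaH_flat` (★ym-routeR-w3 g5) read through `EK` and the translate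
by the middle offset. [cite: Balaban1984PropagatorsI, Prop. 1.1 (1.90) p.33, (1.21) p.21; Balaban1985Variational, Prop. 7 p.299] -/
theorem hH_of_lemmaH_flat (hd : P.d = 3) (hk : k ≤ P.m + P.K) (ψ : SiteField P 0 ℝ)
    (hψ : ∀ x : Site P 0, x ∉ Set.range (embIter k) → laplace 1 (laplace 1 ψ) x = 0) :
    (P.L : ℝ) ^ k * ∑ x : Site P 0, laplace 1 ψ x ^ 2
      ≤ (3 * Real.pi ^ 4 / 4) * ∑ c : PBond P k, (ψ (embIter k c.tgt) - ψ (embIter k c.src)) ^ 2 := by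
  classical
  -- letters
  have hL0 : 0 < P.L := P.L_pos
  have hn1 : 1 ≤ P.L ^ k := Nat.one_le_pow _ _ hL0
  have hn0 : ((P.L ^ k : ℕ) : ℂ) ≠ 0 := by exact_mod_cast (pow_pos hL0 k).ne'
  let E := EK hk
  let w : Tor (fine (P.L ^ k) (Mk P k)) := iota (P.L ^ k) (Mk P k) (fun _ => ⟨(P.L ^ k - 1) / 2, half_pred_pow_lt P k⟩)
  let ψ'' : Tor (fine (P.L ^ k) (Mk P k)) → ℂ := fun s => ((ψ (E.symm (s + w)) : ℝ) : ℂ)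
  let G : Tor (fine (P.L ^ k) (Mk P k)) → ℂ :=
    LapS (fine (P.L ^ k) (Mk P k)) ((P.L ^ k : ℕ) : ℂ) *ᵥ (LapS (fine (P.L ^ k) (Mk P k)) ((P.L ^ k : ℕ) : ℂ) *ᵥ ψ'')
  let qv : Tor (Mk P k) → ℂ := fun y => G (up (P.L ^ k) (Mk P k) y)
  -- (i) the centres under the dictionary
  have hcen : ∀ y : Site P k, E.symm (up (P.L ^ k) (Mk P k) y + w) = embIter k y := fun y => by
    rw [Equiv.symm_apply_eq]
    exact (EK_embIter hk y).symm
  -- (ii) the Laplacians under the dictionary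
  have hLap1 : ∀ t, (LapS (fine (P.L ^ k) (Mk P k)) 1 *ᵥ ψ'') t = ((laplace 1 ψ (E.symm (t + w)) : ℝ) : ℂ) :=
    LapS_one_mulVec_transl hk ψ w
  have hLap2 : ∀ t, (LapS (fine (P.L ^ k) (Mk P k)) 1 *ᵥ (LapS (fine (P.L ^ k) (Mk P k)) 1 *ᵥ ψ'')) t
      = ((laplace 1 (laplace 1 ψ) (E.symm (t + w)) : ℝ) : ℂ) := fun t => by
    rw [show LapS (fine (P.L ^ k) (Mk P k)) 1 *ᵥ ψ'' = fun s => ((laplace 1 ψ (E.symm (s + w)) : ℝ) : ℂ) from funext hLap1]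
    exact LapS_one_mulVec_transl hk (laplace 1 ψ) w t
  have hG : ∀ t, G t = ((P.L ^ k : ℕ) : ℂ) ^ 2 * (((P.L ^ k : ℕ) : ℂ) ^ 2 * ((laplace 1 (laplace 1 ψ) (E.symm (t + w)) : ℝ) : ℂ)) := by
    intro t
    have e1 : LapS (fine (P.L ^ k) (Mk P k)) ((P.L ^ k : ℕ) : ℂ) *ᵥ ψ''
        = (((P.L ^ k : ℕ) : ℂ) ^ 2) • (LapS (fine (P.L ^ k) (Mk P k)) 1 *ᵥ ψ'') :=
      funext fun s => by rw [Pi.smul_apply, smul_eq_mul]; exact LapS_natCast_mulVec _ _ _ s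
    show (LapS _ _ *ᵥ (LapS _ _ *ᵥ ψ'')) t = _
    rw [e1, Matrix.mulVec_smul, Pi.smul_apply, smul_eq_mul, LapS_natCast_mulVec, hLap2 t]
  -- (iii) `G` vanishes off the corner lattice `up(T^{(k)})`
  have hGoff : ∀ t, t ∉ Set.range (up (P.L ^ k) (Mk P k)) → G t = 0 := by
    intro t ht
    have hx : E.symm (t + w) ∉ Set.range (embIter k) := by
      rintro ⟨y, hy⟩
      apply ht
      refine ⟨y, ?_⟩
      have h1 : E (embIter k y) = t + w := by rw [hy, Equiv.apply_symm_apply]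
      rw [EK_embIter hk] at h1
      exact add_right_cancel h1
    rw [hG t, hψ _ hx]
    simp
  -- (iv) `up` is injective and the comb of `qv` IS `G`
  have hup_inj : Function.Injective (up (P.L ^ k) (Mk P k)) := by
    intro y₁ y₂ h
    have hb : bpt (P.L ^ k) (Mk P k) y₁ 0 = bpt (P.L ^ k) (Mk P k) y₂ 0 := by
      have hi : iota (P.L ^ k) (Mk P k) 0 = 0 := funext fun ν => by simp [iota]
      simp only [bpt, hi, add_zero, h]
    have := bpt_injective (P.L ^ k) (Mk P k) (a₁ := (y₁, 0)) (a₂ := (y₂, 0)) hb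
    exact (Prod.ext_iff.mp this).1
  have hcomb : (fun x : Tor (fine (P.L ^ k) (Mk P k)) => ∑ y : Tor (Mk P k), if x = up (P.L ^ k) (Mk P k) y then qv y else 0) = G := by
    funext t
    by_cases ht : t ∈ Set.range (up (P.L ^ k) (Mk P k))
    · obtain ⟨y₀, rfl⟩ := ht
      rw [Finset.sum_eq_single y₀]
      · rw [if_pos rfl]
      · intro y _ hy
        exact if_neg fun h => hy (hup_inj h).symm
      · intro h; exact absurd (Finset.mem_univ y₀) h
    · rw [hGoff t ht]
      exact Finset.sum_eq_zero fun y _ => if_neg fun h => ht ⟨y, h.symm⟩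
  -- (v) zero total charge
  have hq : ∑ y, qv y = 0 := by
    have h1 : ∑ t, G t = ∑ t ∈ Finset.univ.image (up (P.L ^ k) (Mk P k)), G t := by
      refine (Finset.sum_subset (Finset.subset_univ _) fun t _ ht => hGoff t ?_).symm
      intro hr
      obtain ⟨y, rfl⟩ := hr
      exact ht (Finset.mem_image_of_mem _ (Finset.mem_univ y))
    have h2 : ∑ t ∈ Finset.univ.image (up (P.L ^ k) (Mk P k)), G t = ∑ y, qv y :=
      Finset.sum_image fun y₁ _ y₂ _ h => hup_inj h
    rw [← h2, ← h1]
    exact sum_LapS_mulVec _ _ _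
  -- (vi) LEMMA H on the B5 carrier, read back
  have H := Prop7CentreHarmonicDivFlat.lemmaH_flat (P.L ^ k) (Mk P k) hn1 qv hq
  rw [hcomb] at H
  have hS1 : ∑ t, (LapS (fine (P.L ^ k) (Mk P k)) ((P.L ^ k : ℕ) : ℂ) *ᵥ ψ'') t = 0 := sum_LapS_mulVec _ _ _
  have hinv1 : LapSinv (fine (P.L ^ k) (Mk P k)) ((P.L ^ k : ℕ) : ℂ) *ᵥ G
      = LapS (fine (P.L ^ k) (Mk P k)) ((P.L ^ k : ℕ) : ℂ) *ᵥ ψ'' :=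
    LapSinv_LapS_of_orth _ hn0 _ hS1
  have hinv2 : LapSinv (fine (P.L ^ k) (Mk P k)) ((P.L ^ k : ℕ) : ℂ) *ᵥ (LapSinv (fine (P.L ^ k) (Mk P k)) ((P.L ^ k : ℕ) : ℂ) *ᵥ G)
      = ψ'' - Pker (fine (P.L ^ k) (Mk P k)) ((P.L ^ k : ℕ) : ℂ) *ᵥ ψ'' := by
    rw [hinv1, Matrix.mulVec_mulVec, LapSinv_mul_LapS, Matrix.sub_mulVec, Matrix.one_mulVec]
  rw [hinv2, hinv1] at H
  -- (vii) the left side: `n⁴·Σ_x (Δψ)²`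
  have hℓ0 : (0 : ℝ) < (P.L : ℝ) ^ k := by positivity
  have hcast : ((P.L ^ k : ℕ) : ℂ) = (((P.L : ℝ) ^ k : ℝ) : ℂ) := by push_cast; ring
  have hLHS : ∑ t, ‖(LapS (fine (P.L ^ k) (Mk P k)) ((P.L ^ k : ℕ) : ℂ) *ᵥ ψ'') t‖ ^ 2
      = ((P.L : ℝ) ^ k) ^ 4 * ∑ x : Site P 0, laplace 1 ψ x ^ 2 := by
    have e1 : ∀ t, ‖(LapS (fine (P.L ^ k) (Mk P k)) ((P.L ^ k : ℕ) : ℂ) *ᵥ ψ'') t‖ ^ 2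
        = ((P.L : ℝ) ^ k) ^ 4 * laplace 1 ψ (E.symm (t + w)) ^ 2 := by
      intro t
      rw [LapS_natCast_mulVec, hLap1 t, hcast, ← Complex.ofReal_pow, ← Complex.ofReal_mul, Complex.sq_norm, Complex.normSq_ofReal]
      ring
    simp_rw [e1]
    rw [← Finset.mul_sum]
    congr 1
    exact Fintype.sum_equiv ((Equiv.addRight w).trans E.symm) _ _ (fun t => rfl)
  -- (viii) the right side: the coarse differences of `ψ` at the centres
  have hP : ∀ a b, (Pker (fine (P.L ^ k) (Mk P k)) ((P.L ^ k : ℕ) : ℂ) *ᵥ ψ'') a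
      = (Pker (fine (P.L ^ k) (Mk P k)) ((P.L ^ k : ℕ) : ℂ) *ᵥ ψ'') b := fun a b => by
    rw [Pker_const _ hn0 ψ'' a, Pker_const _ hn0 ψ'' b]
  have hRHS : ∑ ν : Fin P.d, ∑ y : Tor (Mk P k),
      ‖(ψ'' - Pker (fine (P.L ^ k) (Mk P k)) ((P.L ^ k : ℕ) : ℂ) *ᵥ ψ'') (up (P.L ^ k) (Mk P k) (y + unitVec (Mk P k) ν))
        - (ψ'' - Pker (fine (P.L ^ k) (Mk P k)) ((P.L ^ k : ℕ) : ℂ) *ᵥ ψ'') (up (P.L ^ k) (Mk P k) y)‖ ^ 2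
      = ∑ c : PBond P k, (ψ (embIter k c.tgt) - ψ (embIter k c.src)) ^ 2 := by
    have e2 : ∀ (ν : Fin P.d) (y : Tor (Mk P k)),
        ‖(ψ'' - Pker (fine (P.L ^ k) (Mk P k)) ((P.L ^ k : ℕ) : ℂ) *ᵥ ψ'') (up (P.L ^ k) (Mk P k) (y + unitVec (Mk P k) ν))
          - (ψ'' - Pker (fine (P.L ^ k) (Mk P k)) ((P.L ^ k : ℕ) : ℂ) *ᵥ ψ'') (up (P.L ^ k) (Mk P k) y)‖ ^ 2
          = (ψ (embIter k (Site.shift (P := P) (j := k) y ν)) - ψ (embIter k y)) ^ 2 := by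
      intro ν y
      rw [Pi.sub_apply, Pi.sub_apply, hP (up (P.L ^ k) (Mk P k) (y + unitVec (Mk P k) ν)) (up (P.L ^ k) (Mk P k) y)]
      have ea : ψ'' (up (P.L ^ k) (Mk P k) (y + unitVec (Mk P k) ν)) = ((ψ (embIter k (Site.shift (P := P) (j := k) y ν)) : ℝ) : ℂ) := by
        show ((ψ (E.symm (up (P.L ^ k) (Mk P k) (y + unitVec (Mk P k) ν) + w)) : ℝ) : ℂ) = _
        rw [← shift_eq_add_unitVec, hcen]
      have eb : ψ'' (up (P.L ^ k) (Mk P k) y) = ((ψ (embIter k y) : ℝ) : ℂ) := by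
        show ((ψ (E.symm (up (P.L ^ k) (Mk P k) y + w)) : ℝ) : ℂ) = _
        rw [hcen]
      rw [ea, eb, show ∀ a b p : ℂ, (a - p) - (b - p) = a - b from fun a b p => by ring, ← Complex.ofReal_sub,
        Complex.sq_norm, Complex.normSq_ofReal]
      ring
    simp_rw [e2]
    rw [sum_pbond, Finset.sum_comm]
    rfl
  rw [hLHS, hRHS] at H
  -- (ix) the arithmetic: `n⁴X ≤ (3π⁴/4)·n³·D` ⇒ `nX ≤ (3π⁴/4)·D`
  have hd3 : ((P.L ^ k : ℕ) : ℝ) ^ P.d = ((P.L : ℝ) ^ k) ^ 3 := by rw [hd]; push_cast; ring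
  have hdc : (P.d : ℝ) = 3 := by exact_mod_cast hd
  rw [hd3, hdc] at H
  have hX0 : 0 ≤ ∑ x : Site P 0, laplace 1 ψ x ^ 2 := Finset.sum_nonneg fun _ _ => sq_nonneg _
  have hD0 : 0 ≤ ∑ c : PBond P k, (ψ (embIter k c.tgt) - ψ (embIter k c.src)) ^ 2 := Finset.sum_nonneg fun _ _ => sq_nonneg _
  have hℓ3 : (0 : ℝ) < ((P.L : ℝ) ^ k) ^ 3 := by positivity
  have key : ((P.L : ℝ) ^ k) ^ 3 * ((P.L : ℝ) ^ k * ∑ x : Site P 0, laplace 1 ψ x ^ 2)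
      ≤ ((P.L : ℝ) ^ k) ^ 3 * ((3 * Real.pi ^ 4 / 4) * ∑ c : PBond P k, (ψ (embIter k c.tgt) - ψ (embIter k c.src)) ^ 2) := by
    have e : ((P.L : ℝ) ^ k) ^ 3 * ((P.L : ℝ) ^ k * ∑ x : Site P 0, laplace 1 ψ x ^ 2) = ((P.L : ℝ) ^ k) ^ 4 * ∑ x : Site P 0, laplace 1 ψ x ^ 2 := by ring
    rw [e]
    refine H.trans (le_of_eq ?_)
    ring
  exact le_of_mul_le_mul_left key hℓ3

/-! ## §4 The unconditional flat ζ-row on `S_H ∩ fibre` -/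

/-- ★★★ **THE FLAT ζ-ROW ON `S_H ∩ fibre`, UNCONDITIONAL** (`d = 3`): for an `M_N(ℂ)`-valued bond field `Y` on the finest torus with `Q^{(k)}Y = 0` (`Q^{(k)}` any composite
of the linearised average) and `Δ(∂^*Y) = 0` off the `k`-centres,
`Σ_x ‖(∂^*Y)(x)‖²_F ≤ (3π⁴/4)·(2 + 600·N²·L⁴/(√L − 1)²)·Σ_p ‖(∂Y)(p)‖²_F` — uniformly in `k` and in the volume (ENGINE ✓`sum_diverg_normSq_le_curl_normSq_of_centreHarmonic`
+ §3). [cite: Balaban1984PropagatorsI, Prop. 1.1 (1.90) p.33; Balaban1985Variational, Prop. 7 p.299, (141)-(143) p.299; Balaban1985BackgroundPropagators, Thm 3.11 p.416] -/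
theorem sum_diverg_normSq_le_curl_normSq (hd : P.d = 3) {N : ℕ} [NeZero N]
    (Q : (i : ℕ) → (PBond P 0 → Matrix (Fin N) (Fin N) ℂ) → PBond P i → Matrix (Fin N) (Fin N) ℂ)
    (hQ0 : ∀ Y, Q 0 Y = Y)
    (hQs : ∀ (i : ℕ) (Y : PBond P 0 → Matrix (Fin N) (Fin N) ℂ) (c : PBond P (i + 1)), Q (i + 1) Y c = linAvg (Q i Y) c)
    (Y : PBond P 0 → Matrix (Fin N) (Fin N) ℂ) (hk : k ≤ P.m + P.K) (hQY : ∀ c : PBond P k, Q k Y c = 0)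
    (hSH : ∀ x : Site P 0, x ∉ Set.range (embIter k) → laplace 1 (diverg 1 Y) x = 0) :
    ∑ x : Site P 0, ∑ a : Fin N, ∑ b' : Fin N, Complex.normSq ((diverg 1 Y x) a b')
      ≤ (3 * Real.pi ^ 4 / 4) * (2 + 600 * (N : ℝ) ^ 2 * (P.L : ℝ) ^ 4 / (Real.sqrt P.L - 1) ^ 2)
          * ∑ p : Plaq P 0, ∑ a : Fin N, ∑ b' : Fin N, Complex.normSq ((curl 1 Y p) a b') :=
  Prop7CentreHarmonicDivEngine.sum_diverg_normSq_le_curl_normSq_of_centreHarmonic hd Q hQ0 hQs Y hk hQY hSH (by positivity)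
    (fun ψ hψ => hH_of_lemmaH_flat hd hk ψ hψ)

/-- ★ **THE T³ INSTANCE** (run `K` of a T³ family, comparison height `n`, `k = K − n`): the flat ζ-row for `Q^{(K−n)}Y = 0`, `Δ(∂^*Y) = 0` off the `(K−n)`-centres, with the
L-only constant `(3π⁴/4)(2 + 600N²L⁴/(√L − 1)²)`, uniformly in `m`, `n`, `K`. [cite: Balaban1984PropagatorsI, Prop. 1.1 (1.90) p.33; Balaban1985Variational, Prop. 7 p.299] -/
theorem sum_diverg_normSq_le_curl_normSq_T3 (F : T3ContinuumYM3Torus.T3Family) (K n : ℕ) {N : ℕ} [NeZero N]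
    (Q : (i : ℕ) → (PBond (F.P K) 0 → Matrix (Fin N) (Fin N) ℂ) → PBond (F.P K) i → Matrix (Fin N) (Fin N) ℂ)
    (hQ0 : ∀ Y, Q 0 Y = Y)
    (hQs : ∀ (i : ℕ) (Y : PBond (F.P K) 0 → Matrix (Fin N) (Fin N) ℂ) (c : PBond (F.P K) (i + 1)), Q (i + 1) Y c = linAvg (Q i Y) c)
    (Y : PBond (F.P K) 0 → Matrix (Fin N) (Fin N) ℂ) (hQY : ∀ c : PBond (F.P K) (K - n), Q (K - n) Y c = 0)
    (hSH : ∀ x : Site (F.P K) 0, x ∉ Set.range (embIter (K - n)) → laplace 1 (diverg 1 Y) x = 0) :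
    ∑ x : Site (F.P K) 0, ∑ a : Fin N, ∑ b' : Fin N, Complex.normSq ((diverg 1 Y x) a b')
      ≤ (3 * Real.pi ^ 4 / 4) * (2 + 600 * (N : ℝ) ^ 2 * (F.L : ℝ) ^ 4 / (Real.sqrt F.L - 1) ^ 2)
          * ∑ p : Plaq (F.P K) 0, ∑ a : Fin N, ∑ b' : Fin N, Complex.normSq ((curl 1 Y p) a b') := by
  have hk : K - n ≤ (F.P K).m + (F.P K).K := by
    have := F.hm
    show K - n ≤ F.m + K
    omega
  exact sum_diverg_normSq_le_curl_normSq (P := F.P K) (T3ContinuumYM3Torus.T3Family.P_d F K) Q hQ0 hQs Y hk hQY hSH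

end Summit.QuantumFields.YangMills.Theorems.Prop7CentreHarmonicDivDictionary

end
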